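import Mathlib.AlgebraicGeometry.Morphisms.Separated
import Mathlib.AlgebraicGeometry.Morphisms.Proper
import Mathlib.AlgebraicGeometry.Geometrically.Integral
import Mathlib.AlgebraicGeometry.Sites.Fpqc
import Mathlib.CategoryTheory.Monoidal.Cartesian.Over
import Literature.NumberTheory.DiophantineGeometry.AVIsogenyTate
import HarnessLib

/-!
# Quasi-inverse of an isogeny of abelian varieties: decomposition of the proof

This file decomposes the classical fact `Literature.AlgebraicGeometry.Motives.AbelianVariety.IsIsogeny.exists_nsmul_inverse`
(an isogeny `f : A → B` of abelian varieties over a field `K` has a quasi-inverse `g : B → A`,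
`g ∘ f = [n]_A`, `f ∘ g = [n]_B` for some `n ≥ 1`; Mumford, *Abelian Varieties*, §19, Remark
p. 169; Görtz–Wedhorn, *Algebraic Geometry II*, Prop. 27.190) along the printed proof
(Görtz–Wedhorn II, proof of Prop. 27.190, p. 889):

1. `Ker f` is a finite (locally free) group scheme of rank `n = deg f`, hence is annihilated by
   `n` (Görtz–Wedhorn II, Prop. 27.86 — Deligne's theorem — and Cor. 27.177); vendored as the
   named fact `IsIsogeny.exists_kerPoints_le_nsmul` (in functor-of-points form:
   `Ker f (T) ≤ A[n](T)` for every `K`-scheme `T`).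
2. Hence `[n]_A` factors as `g ∘ f`: an isogeny is faithfully flat (Görtz–Wedhorn II,
   Prop. 27.54), so `B ≅ A / Ker f` as fppf sheaves (loc. cit. (27.33), p. 882 (1)) and every
   homomorphism `h : A → C` with `Ker f ⊆ Ker h` factors uniquely through `f`; vendored as the
   named fact `IsIsogeny.exists_comp_eq_of_kerPoints_le`, with the flatness input recorded
   separately as `IsIsogeny.flat_toSchemeHom` (from which, together with Mathlib's
   `EffectiveEpi` instance for flat surjective quasi-compact morphisms,
   `Mathlib.AlgebraicGeometry.Sites.Fpqc`, item 2 is expected to follow).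
3. `f ∘ g = [n]_B` because an isogeny is an epimorphism among homomorphisms (Görtz–Wedhorn II,
   Prop. 27.178 (1)); this is **proved** here (`IsIsogeny.cancel_left`, `IsIsogeny.epi`) from
   Mathlib's `ext_of_isDominant_of_isSeparated` (a surjective morphism to a reduced scheme is
   an epimorphism for morphisms into a separated scheme).
4. The assembly `IsIsogeny.exists_nsmul_inverse_of` of the target fact from items 1 and 2 is
   **proved** here.

## Design notes

* `Hom.kerPoints f T` is the kernel of `f` on `T`-valued points, a `Subgroup (T ⟶ A.X)` for
  Mathlib's scoped group structure `Hom.group` on points of a group object; by Yoneda,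
  `(∀ T, kerPoints f T ≤ kerPoints h T)` is the scheme-theoretic inclusion `Ker f ⊆ Ker h`, and
  no representability of kernels is needed to *state* items 1–2.
* Nothing here is stated stronger than the source: item 1 is the existence corollary of
  Prop. 27.86 + Cor. 27.177 (the source has `n = deg f`; `deg` is not yet defined in this
  library), item 2 is the existence half of the universal property of the quotient
  `A → A / Ker f = B`.
* Mathlib searched: `Epi`, `EffectiveEpi` (fpqc, used only in a docstring), `IsDominant`,
  `ext_of_isDominant_of_isSeparated`, `GeometricallyIntegral.isIntegral_of_subsingleton`,
  `IsMonHom.monoidHom` (all used); Mathlib has no isogenies / finite group schemes / Deligne's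
  theorem.

## References

* D. Mumford, *Abelian Varieties* (1970), §19, Remark p. 169; §12, Thm. 1; §7, Thm. 4.
* U. Görtz, T. Wedhorn, *Algebraic Geometry II: Cohomology of Schemes* (2023), Prop. 27.54,
  Prop. 27.86, Cor. 27.177, Prop. 27.178, Prop. 27.190.
* J. S. Milne, *Abelian Varieties* (course notes), §8.
-/

universe u

open CategoryTheory AlgebraicGeometry MonoidalCategory

noncomputable section

namespace Literature.NumberTheory.DiophantineGeometry

section AbelianVariety
open Literature.AlgebraicGeometry.Motives (AbelianVariety)
open Literature.AlgebraicGeometry.Motives.AbelianVariety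

open scoped MonObj

variable {K : Type u} [Field K] {A B C : AbelianVariety K}

/-! ### Kernels on points -/

section Hom
open Literature.AlgebraicGeometry.Motives.AbelianVariety.Hom

variable (T : Literature.AlgebraicGeometry.Motives.SchemeOver K)

/-- The kernel of a homomorphism `f : A → B` on `T`-valued points, `Ker f (T) = {x ∈ A(T) | f x = 1}`,
as a subgroup of the group `A(T) = (T ⟶ A.X)` of `T`-points of the group scheme `A.X` (Mathlib's
scoped `Hom.group`; the kernel of Mathlib's `IsMonHom.monoidHom`). By Yoneda this is the functor
of points of the scheme-theoretic kernel `Ker f = A ×_B Spec K` (Görtz–Wedhorn II, (27.1.1),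
PDF p. 800 of the held copy: `Ker(f)(T) = Ker(f(T) : G(T) → H(T))`; Mumford §12). [folklore] -/
def _root_.Literature.AlgebraicGeometry.Motives.AbelianVariety.Hom.kerPoints (f : A ⟶ B) : Subgroup (T ⟶ A.X) :=
  (IsMonHom.monoidHom f.hom.hom.hom T).ker

variable {T}

/-- Membership in `Ker f (T)` unfolds to `x ≫ f = 1`. [folklore] -/
theorem _root_.Literature.AlgebraicGeometry.Motives.AbelianVariety.Hom.mem_kerPoints_iff (f : A ⟶ B) (x : T ⟶ A.X) :
    x ∈ kerPoints T f ↔ x ≫ f.hom.hom.hom = 1 :=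
  Iff.rfl

/-- The unit `T`-point lies in `Ker f (T)`. [folklore] -/
theorem _root_.Literature.AlgebraicGeometry.Motives.AbelianVariety.Hom.one_mem_kerPoints (f : A ⟶ B) : (1 : T ⟶ A.X) ∈ kerPoints T f :=
  Subgroup.one_mem _

/-- `Ker (𝟙 A) (T)` is trivial. [folklore] -/
@[simp]
theorem _root_.Literature.AlgebraicGeometry.Motives.AbelianVariety.Hom.kerPoints_id (A : AbelianVariety K) : kerPoints T (𝟙 A) = ⊥ := by
  ext x
  rw [mem_kerPoints_iff, Subgroup.mem_bot]
  exact Iff.of_eq (congrArg (· = 1) (Category.comp_id x))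

/-- `Ker f (T) ≤ Ker (f ≫ g) (T)`. [folklore] -/
theorem _root_.Literature.AlgebraicGeometry.Motives.AbelianVariety.Hom.kerPoints_le_kerPoints_comp (f : A ⟶ B) (g : B ⟶ C) :
    kerPoints T f ≤ kerPoints T (f ≫ g) := by
  intro x hx
  rw [mem_kerPoints_iff] at hx ⊢
  change x ≫ (f.hom.hom.hom ≫ g.hom.hom.hom) = 1
  rw [← Category.assoc, hx, MonObj.one_comp]

end Hom

open Hom Literature.AlgebraicGeometry.Motives.AbelianVariety.Hom

/-! ### Isogenies are epimorphisms (Görtz–Wedhorn II, Prop. 27.178 (1)) -/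

/-- The underlying scheme of an abelian variety is integral (geometrically integral over a
field implies integral; Mathlib `GeometricallyIntegral.isIntegral_of_subsingleton`). [folklore] -/
instance _root_.Literature.AlgebraicGeometry.Motives.AbelianVariety.isIntegral_left (A : AbelianVariety K) : IsIntegral A.X.left :=
  GeometricallyIntegral.isIntegral_of_subsingleton A.X.hom

/-- A homomorphism of abelian varieties whose underlying morphism of schemes is surjective is
left-cancellable among homomorphisms: `f ≫ g₁ = f ≫ g₂ → g₁ = g₂` (`B` is reduced, `C` is
separated over `K`, and two morphisms from a reduced scheme to a separated scheme that agree
after a dominant morphism are equal; Görtz–Wedhorn II, Prop. 27.178 (1) and Lemma 27.50;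
Mathlib `ext_of_isDominant_of_isSeparated`). [cite: GortzWedhorn2023, Prop. 27.178 (1)] -/
theorem _root_.Literature.AlgebraicGeometry.Motives.AbelianVariety.cancel_left_of_surjective {f : A ⟶ B} (hf : Surjective (Hom.toSchemeHom f))
    {g₁ g₂ : B ⟶ C} (h : f ≫ g₁ = f ≫ g₂) : g₁ = g₂ := by
  have hfg : Hom.toSchemeHom f ≫ Hom.toSchemeHom g₁ = Hom.toSchemeHom f ≫ Hom.toSchemeHom g₂ :=
    congrArg Hom.toSchemeHom h
  apply hom_ext
  ext : 1
  change Hom.toSchemeHom g₁ = Hom.toSchemeHom g₂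
  refine ext_of_isDominant_of_isSeparated C.X.hom ?_ (Hom.toSchemeHom f) hfg
  rw [Over.w, Over.w]

/-- An isogeny is left-cancellable among homomorphisms of abelian varieties:
`f ≫ g₁ = f ≫ g₂ → g₁ = g₂` (Görtz–Wedhorn II, Prop. 27.178 (1); Mumford §19). [cite: GortzWedhorn2023, Prop. 27.178 (1)] -/
theorem _root_.Literature.AlgebraicGeometry.Motives.AbelianVariety.IsIsogeny.cancel_left {f : A ⟶ B} (hf : IsIsogeny f) {g₁ g₂ : B ⟶ C}
    (h : f ≫ g₁ = f ≫ g₂) : g₁ = g₂ :=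
  cancel_left_of_surjective hf.1 h

/-- An isogeny is an epimorphism in the category of abelian varieties over `K`
(Görtz–Wedhorn II, Prop. 27.178 (1)). [cite: GortzWedhorn2023, Prop. 27.178 (1)] -/
theorem _root_.Literature.AlgebraicGeometry.Motives.AbelianVariety.IsIsogeny.epi {f : A ⟶ B} (hf : IsIsogeny f) : Epi f :=
  ⟨fun _ _ h ↦ hf.cancel_left h⟩

/-! ### The two deep inputs (named facts) and flatness -/

/-- **The kernel of an isogeny is annihilated by a positive integer.** If `f : A → B` is an
isogeny, there is `n ≥ 1` with `Ker f ⊆ A[n] = Ker [n]_A` scheme-theoretically, i.e.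
`Ker f (T) ≤ A[n](T)` for every `K`-scheme `T`. In the source `n = deg f`, the rank of the finite
locally free group scheme `Ker f` (Görtz–Wedhorn II, Cor. 27.177), which annihilates `Ker f` by
Deligne's theorem (Görtz–Wedhorn II, Prop. 27.86); Mumford §19, Remark p. 169 ("if `f` is an
isogeny of degree `n`, `ker f ⊂ X_n`"). Stated as an existence because `deg f` is not yet defined
in this library. [cite: GortzWedhorn2023, Prop. 27.86 and Cor. 27.177 (proof of Prop. 27.190)] -/
def _root_.Literature.AlgebraicGeometry.Motives.AbelianVariety.IsIsogeny.exists_kerPoints_le_nsmul : Prop :=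
  ∀ {f : A ⟶ B} (_hf : IsIsogeny f),
    ∃ n : ℕ, 0 < n ∧ ∀ T : Literature.AlgebraicGeometry.Motives.SchemeOver K, kerPoints T f ≤ kerPoints T (n • 𝟙 A)

/-- **An isogeny is the quotient by its kernel (existence half of the universal property).**
If `f : A → B` is an isogeny and `h : A → C` is a homomorphism of abelian varieties with
`Ker f ⊆ Ker h` scheme-theoretically (`Ker f (T) ≤ Ker h (T)` for all `K`-schemes `T`), then
`h = g ∘ f` for some homomorphism `g : B → C`. Source: an isogeny (indeed any surjective
homomorphism from a flat group scheme to one with geometrically reduced fibres) is faithfully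
flat of finite presentation, hence fppf-surjective, and induces `A / Ker f ≅ B`
(Görtz–Wedhorn II, Prop. 27.54 and (27.33), p. 882 (1); Mumford §12, Thm. 1 (Cor. 1) and §7,
Thm. 4). The homomorphism `g` is unique by `IsIsogeny.cancel_left`. [cite: GortzWedhorn2023, Prop. 27.54 and §(27.33) p. 882 (1)] -/
def _root_.Literature.AlgebraicGeometry.Motives.AbelianVariety.IsIsogeny.exists_comp_eq_of_kerPoints_le : Prop :=
  ∀ {f : A ⟶ B} (_hf : IsIsogeny f) (h : A ⟶ C)
    (_hle : ∀ T : Literature.AlgebraicGeometry.Motives.SchemeOver K, kerPoints T f ≤ kerPoints T h),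
    ∃ g : B ⟶ C, f ≫ g = h

/-- **An isogeny is flat** (indeed finite locally free): a surjective homomorphism from a flat
group scheme of finite presentation to a separated group scheme with geometrically reduced
fibres is faithfully flat (Görtz–Wedhorn II, Prop. 27.54; Cor. 27.177 (1)). This is the input
from which `IsIsogeny.exists_comp_eq_of_kerPoints_le` follows by fpqc descent of morphisms
(Mathlib: a flat surjective quasi-compact morphism is an `EffectiveEpi`). [cite: GortzWedhorn2023, Prop. 27.54 and Cor. 27.177 (1)] -/
def _root_.Literature.AlgebraicGeometry.Motives.AbelianVariety.IsIsogeny.flat_toSchemeHom : Prop :=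
  ∀ {f : A ⟶ B} (_hf : IsIsogeny f), Flat (Hom.toSchemeHom f)

/-! ### The quotient property from flatness (fpqc descent of morphisms) -/

section Descent

/-- `toSchemeHom` is functorial. [folklore] -/
theorem _root_.Literature.AlgebraicGeometry.Motives.AbelianVariety.toSchemeHom_comp (f : A ⟶ B) (g : B ⟶ C) :
    Hom.toSchemeHom (f ≫ g) = Hom.toSchemeHom f ≫ Hom.toSchemeHom g := rfl

/-- The descent condition: if `Ker f ⊆ Ker h` scheme-theoretically then `h` coequalises the
kernel pair of `f`, i.e. `g₁ ≫ f = g₂ ≫ f → g₁ ≫ h = g₂ ≫ h` for all scheme morphisms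
`g₁ g₂ : Z → A` (`g₁ g₂⁻¹` is a `Z`-point of `Ker f`; Görtz–Wedhorn II, (27.9.1) and the display
`(g₁, g₂) ∈ (G ×_{G/H} G)(T) ⇔ g₂⁻¹ g₁ ∈ H(T)` in the proof of Lemma 27.59, PDF p. 823).
[folklore] -/
theorem _root_.Literature.AlgebraicGeometry.Motives.AbelianVariety.comp_toSchemeHom_eq_of_kerPoints_le (f : A ⟶ B) (h : A ⟶ C)
    (hle : ∀ T : Literature.AlgebraicGeometry.Motives.SchemeOver K, kerPoints T f ≤ kerPoints T h) {Z : Scheme.{u}}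
    (g₁ g₂ : Z ⟶ A.X.left) (hg : g₁ ≫ Hom.toSchemeHom f = g₂ ≫ Hom.toSchemeHom f) :
    g₁ ≫ Hom.toSchemeHom h = g₂ ≫ Hom.toSchemeHom h := by
  have hw : g₂ ≫ A.X.hom = g₁ ≫ A.X.hom := by
    rw [← Over.w f.hom.hom.hom, ← Category.assoc, ← Category.assoc]
    exact congrArg (· ≫ B.X.hom) hg.symm
  let T : Literature.AlgebraicGeometry.Motives.SchemeOver K := Over.mk (g₁ ≫ A.X.hom)
  let x₁ : T ⟶ A.X := Over.homMk g₁ rfl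
  let x₂ : T ⟶ A.X := Over.homMk g₂ hw
  have hx : IsMonHom.monoidHom f.hom.hom.hom T x₁ = IsMonHom.monoidHom f.hom.hom.hom T x₂ :=
    Over.OverMorphism.ext hg
  have hmem : x₁ * x₂⁻¹ ∈ kerPoints T f := by
    change IsMonHom.monoidHom f.hom.hom.hom T (x₁ * x₂⁻¹) = 1
    rw [map_mul, map_inv, mul_inv_eq_one, hx]
  have hmem' : IsMonHom.monoidHom h.hom.hom.hom T (x₁ * x₂⁻¹) = 1 := hle T hmem
  rw [map_mul, map_inv, mul_inv_eq_one] at hmem'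
  exact congrArg CommaMorphism.left hmem'

/-- A property of scheme morphisms stable under base change and composition passes from the
underlying morphism of `f` to that of `f ⊗ f = f ×_K f`. [folklore] -/
theorem _root_.Literature.AlgebraicGeometry.Motives.AbelianVariety.tensorHom_left_of_isStableUnderBaseChange (P : MorphismProperty Scheme.{u})
    [P.IsStableUnderBaseChange] [P.IsStableUnderComposition] {X Y : Literature.AlgebraicGeometry.Motives.SchemeOver K} (φ : X ⟶ Y)
    (hφ : P φ.left) : P (φ ⊗ₘ φ).left := by
  rw [Over.tensorHom_left]
  exact MorphismProperty.pullbackMap hφ hφ (Over.w φ).symm (Over.w φ).symm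

/-- **The quotient property of an isogeny, from flatness.** If `f : A → B` is an isogeny whose
underlying morphism of schemes is flat, and `h : A → C` is a homomorphism with `Ker f ⊆ Ker h`
scheme-theoretically, then `h = g ∘ f` for a (unique) homomorphism `g : B → C`. Proof: `f` is
flat, surjective and quasi-compact, hence an effective epimorphism of schemes (fpqc descent of
morphisms, Mathlib `Mathlib.AlgebraicGeometry.Sites.Fpqc`); `h` coequalises the kernel pair of
`f` (`comp_toSchemeHom_eq_of_kerPoints_le`), so descends to `g : B → C` over `K`; `g` respects
the units since `f` and `h` do, and the multiplications since `f ×_K f` is again an (effective)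
epimorphism (Görtz–Wedhorn II, Prop. 27.54 and (27.33), p. 882 (1); Mumford §12, Thm. 1). [cite: GortzWedhorn2023, §(27.33) p. 882 (1)] -/
theorem _root_.Literature.AlgebraicGeometry.Motives.AbelianVariety.IsIsogeny.exists_comp_eq_of_kerPoints_le_of_flat {f : A ⟶ B} (hf : IsIsogeny f)
    (hflat : Flat (Hom.toSchemeHom f)) (h : A ⟶ C)
    (hle : ∀ T : Literature.AlgebraicGeometry.Motives.SchemeOver K, kerPoints T f ≤ kerPoints T h) :
    ∃ g : B ⟶ C, f ≫ g = h := by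
  obtain ⟨hsurj, hfin⟩ := hf
  -- `f` is an effective epimorphism of schemes; descend `h`.
  let g' : B.X.left ⟶ C.X.left :=
    EffectiveEpi.desc (Hom.toSchemeHom f) (Hom.toSchemeHom h)
      (fun g₁ g₂ hg ↦ comp_toSchemeHom_eq_of_kerPoints_le f h hle g₁ g₂ hg)
  have fac : Hom.toSchemeHom f ≫ g' = Hom.toSchemeHom h := EffectiveEpi.fac _ _ _
  have hw : g' ≫ C.X.hom = B.X.hom := by
    rw [← cancel_epi (Hom.toSchemeHom f), ← Category.assoc, fac]
    exact (Over.w h.hom.hom.hom).trans (Over.w f.hom.hom.hom).symm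
  let gO : B.X ⟶ C.X := Over.homMk g' hw
  have facO : f.hom.hom.hom ≫ gO = h.hom.hom.hom := Over.OverMorphism.ext fac
  -- `gO` is a homomorphism of group schemes.
  have one : η[B.X] ≫ gO = η[C.X] := by
    rw [← IsMonHom.one_hom f.hom.hom.hom, Category.assoc, facO, IsMonHom.one_hom]
  have : Surjective (f.hom.hom.hom ⊗ₘ f.hom.hom.hom).left :=
    tensorHom_left_of_isStableUnderBaseChange @Surjective _ hsurj
  have : Flat (f.hom.hom.hom ⊗ₘ f.hom.hom.hom).left :=
    tensorHom_left_of_isStableUnderBaseChange @Flat _ hflat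
  have : QuasiCompact (f.hom.hom.hom ⊗ₘ f.hom.hom.hom).left :=
    tensorHom_left_of_isStableUnderBaseChange @QuasiCompact _ inferInstance
  have : Epi (f.hom.hom.hom ⊗ₘ f.hom.hom.hom) := Over.epi_of_epi_left _
  have mul : μ[B.X] ≫ gO = (gO ⊗ₘ gO) ≫ μ[C.X] := by
    rw [← cancel_epi (f.hom.hom.hom ⊗ₘ f.hom.hom.hom), ← Category.assoc, ← IsMonHom.mul_hom,
      Category.assoc, facO, IsMonHom.mul_hom, ← Category.assoc, tensorHom_comp_tensorHom, facO]
  exact ⟨InducedCategory.homMk (Grp.homMk'' gO one mul), hom_ext _ _ facO⟩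

/-- The named fact `IsIsogeny.exists_comp_eq_of_kerPoints_le` follows from the flatness of
isogenies `IsIsogeny.flat_toSchemeHom` (fpqc descent, see
`IsIsogeny.exists_comp_eq_of_kerPoints_le_of_flat`). [folklore] -/
theorem _root_.Literature.AlgebraicGeometry.Motives.AbelianVariety.IsIsogeny.exists_comp_eq_of_kerPoints_le_of_flat_toSchemeHom
    (h₄ : IsIsogeny.flat_toSchemeHom (A := A) (B := B)) :
    IsIsogeny.exists_comp_eq_of_kerPoints_le (A := A) (B := B) (C := C) :=
  fun hf h hle ↦ hf.exists_comp_eq_of_kerPoints_le_of_flat (h₄ hf) h hle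

end Descent

/-! ### Assembly (Görtz–Wedhorn II, proof of Prop. 27.190; Mumford §19, Remark p. 169) -/

/-- **Quasi-inverse of an isogeny, from the two inputs.** If the kernel of every isogeny
`A → B` is annihilated by a positive integer (`IsIsogeny.exists_kerPoints_le_nsmul`) and every
isogeny `A → B` has the quotient property towards `A` (`IsIsogeny.exists_comp_eq_of_kerPoints_le`
with `C = A`), then every isogeny `f : A → B` has a quasi-inverse `g` with `g ∘ f = [n]_A` and
`f ∘ g = [n]_B`, `n ≥ 1`. The proof is the printed one: `[n]_A` kills `Ker f`, so
`[n]_A = g ∘ f`; then `f ∘ g ∘ f = f ∘ [n]_A = [n]_B ∘ f` and `f` is an epimorphism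
(`IsIsogeny.cancel_left`). (Görtz–Wedhorn II, Prop. 27.190; Mumford §19, Remark p. 169.) [cite: GortzWedhorn2023, Prop. 27.190] -/
theorem _root_.Literature.AlgebraicGeometry.Motives.AbelianVariety.IsIsogeny.exists_nsmul_inverse_of
    (h₂ : IsIsogeny.exists_kerPoints_le_nsmul (A := A) (B := B))
    (h₃ : IsIsogeny.exists_comp_eq_of_kerPoints_le (A := A) (B := B) (C := A)) :
    IsIsogeny.exists_nsmul_inverse (A := A) (B := B) := by
  intro f hf
  obtain ⟨n, hn, hle⟩ := h₂ hf
  obtain ⟨g, hg⟩ := h₃ hf (n • 𝟙 A) hle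
  refine ⟨g, n, hn, hg, hf.cancel_left ?_⟩
  rw [← Category.assoc, hg, Preadditive.nsmul_comp, Preadditive.comp_nsmul, Category.id_comp,
    Category.comp_id]

/-- **Quasi-inverse of an isogeny, from Deligne's theorem and flatness.** The target fact
`IsIsogeny.exists_nsmul_inverse` for `A`, `B` follows from the two remaining named inputs:
the kernel of an isogeny `A → B` is annihilated by a positive integer
(`IsIsogeny.exists_kerPoints_le_nsmul`, Görtz–Wedhorn II, Prop. 27.86 + Cor. 27.177) and
isogenies `A → B` are flat (`IsIsogeny.flat_toSchemeHom`, Görtz–Wedhorn II, Prop. 27.54); the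
quotient property is then fpqc descent (`IsIsogeny.exists_comp_eq_of_kerPoints_le_of_flat`) and
the rest is the printed proof of Görtz–Wedhorn II, Prop. 27.190 (= Mumford §19, Remark
p. 169). [cite: GortzWedhorn2023, Prop. 27.190] -/
theorem _root_.Literature.AlgebraicGeometry.Motives.AbelianVariety.IsIsogeny.exists_nsmul_inverse_of_flat_toSchemeHom
    (h₂ : IsIsogeny.exists_kerPoints_le_nsmul (A := A) (B := B))
    (h₄ : IsIsogeny.flat_toSchemeHom (A := A) (B := B)) :
    IsIsogeny.exists_nsmul_inverse (A := A) (B := B) :=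
  IsIsogeny.exists_nsmul_inverse_of h₂
    (IsIsogeny.exists_comp_eq_of_kerPoints_le_of_flat_toSchemeHom h₄)

end AbelianVariety

end Literature.NumberTheory.DiophantineGeometry
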